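import Literature.Geometry.Kaehler.HodgeStarProofs

/-!
# The pointwise Hodge star is an isometry: `⟪⋆α, ⋆β⟫ = ⟪α, β⟫` (proof)

This file discharges the named fact `Literature.Geometry.Kaehler.alternatingFormInner_hodgeStar_hodgeStar` of
`Literature/Geometry/Kaehler/HodgeStar.lean`:

* `Literature.alternatingFormInner_hodgeStar_hodgeStar_holds : alternatingFormInner_hodgeStar_hodgeStar o`
  — the Hodge star is an isometry for the induced inner products on forms, `⟪⋆α, ⋆β⟫ = ⟪α, β⟫`,
  for continuous alternating `k`-forms on an oriented `n`-dimensional real inner product space,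
  `k + m = n` (Warner, *Foundations of Differentiable Manifolds and Lie Groups*, GTM 94, Ch. 2,
  Exercise 13, eqs. (1) and (3), pp. 79–80: `⋆` carries the orthonormal basis
  `e_{i₁} ∧ ⋯ ∧ e_{i_p}` of `Λ_p(V)` to `±` the orthonormal basis of `Λ_{n-p}(V)`).

(This theorem first landed appended to `HodgeStarProofs.lean` (p7994); it is kept in its own file so
that whole-file updates of that module cannot drop it.)

## Proof

Warner's Exercise 2.13 defines `⋆` by `⋆(e_1 ∧ ⋯ ∧ e_p) = ± e_{p+1} ∧ ⋯ ∧ e_n` for *any* orthonormal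
basis (eq. (3)), and the `e_{i₁} ∧ ⋯ ∧ e_{i_p}`, `i₁ < ⋯ < i_p`, form an orthonormal basis of
`Λ_p(V)` (eq. (1)); so `⋆` maps an orthonormal basis to `±` an orthonormal basis and preserves the
inner product. The isometry itself is not displayed separately by Warner (it is this immediate
consequence of (1) and (3), and also follows from his eqs. (5) `⋆⋆ = (-1)^{p(n-p)}` and (6)
`⟨v, w⟩ = ⋆(v ∧ ⋆w)`); the fact's own tag "Ex. 2.13 (e)" refers to this consequence.

On Mathlib's model (`HodgeStar.lean`, `HodgeStarProofs.lean`): with `b = stdOrthonormalBasisFin V n`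
and `e s` the increasing enumeration of `s : Set.powersetCard (Fin n) k`,

1. `(⋆β)(b ∘ e t) = ∑ₛ β(b ∘ e s) · vol(b ∘ [e s | e t])`
   (`HodgeStarAux.hodgeStar_apply_multiIndex`), and `vol(b ∘ [e s | e t]) = 0` unless `s = tᶜ`
   (a repeated basis vector, `HodgeStarAux.volumeForm_append_cast_eq_zero`), so the sum collapses to
   `(⋆β)(b ∘ e t) = β(b ∘ e tᶜ) · vol(b ∘ [e tᶜ | e t])` (`hodgeStar_apply_multiIndex_eq_compl`) —
   Warner's eq. (3) read off on basis tuples;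
2. the volume factor squares to `1`, `b ∘ [e tᶜ | e t]` being a permuted orthonormal basis
   (`volumeForm_compl_append_mul_self`, from `HodgeStarAux.volumeForm_comp_mul_self`);
3. hence `⟪⋆α, ⋆β⟫ = ∑_t (⋆α)(b ∘ e t) (⋆β)(b ∘ e t) = ∑_t α(b ∘ e tᶜ) β(b ∘ e tᶜ)`
   (`alternatingFormInner_apply`), which is `∑_s α(b ∘ e s) β(b ∘ e s) = ⟪α, β⟫` after reindexing
   along the bijection `t ↦ tᶜ` (`Set.powersetCard.compl`) between `m`- and `k`-subsets of `Fin n`.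

## References

* F. W. Warner, *Foundations of Differentiable Manifolds and Lie Groups*, GTM 94, Springer (1983),
  Ch. 2, Exercise 13 (pp. 79–80, the star operator `*`: eq. (1) the inner product on `Λ(V)` and the
  orthonormal basis 2.6(1), eq. (3) the definition of `*` on orthonormal bases, eq. (5)
  `** = (-1)^{p(n-p)}`, eq. (6) `⟨v, w⟩ = *(w ∧ *v)`).
-/

noncomputable section

open Module ContinuousAlternatingMap Function Set.powersetCard

namespace Literature.Geometry.Kaehler

namespace HodgeStarAux

/-! ### The Hodge star as the signed complement on increasing basis tuples -/

section StarCompl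

variable {V : Type*} [NormedAddCommGroup V] [InnerProductSpace ℝ V] [FiniteDimensional ℝ V]
  {n : ℕ} [Fact (finrank ℝ V = n)] (o : Orientation ℝ V (Fin n)) {k m : ℕ}

/-- The Hodge star on an increasing basis tuple `b ∘ e t` (`b = stdOrthonormalBasisFin V n`)
collapses to the complementary multi-index: `(⋆β)(b ∘ e t) = β(b ∘ e tᶜ) · vol(b ∘ [e tᶜ | e t])`,
i.e. Warner's `⋆(e_1 ∧ ⋯ ∧ e_p) = ± e_{p+1} ∧ ⋯ ∧ e_n` (Ch. 2, Ex. 13 (3), p. 80) read off on basis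
tuples; all other terms of `hodgeStar_apply_multiIndex` contain a repeated basis vector.
[folklore] -/
theorem hodgeStar_apply_multiIndex_eq_compl (h : k + m = n) (hc : k + m = Fintype.card (Fin n))
    (β : V [⋀^Fin k]→L[ℝ] ℝ) (t : Set.powersetCard (Fin n) m) :
    hodgeStar o h β ((stdOrthonormalBasisFin V n).multiIndex t) =
      β ((stdOrthonormalBasisFin V n).multiIndex (compl hc t)) *
        o.volumeForm (stdOrthonormalBasisFin V n ∘
          (Fin.append (ofFinEmbEquiv.symm (compl hc t)) (ofFinEmbEquiv.symm t) ∘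
            Fin.cast h.symm)) := by
  rw [hodgeStar_apply_multiIndex]
  refine Fintype.sum_eq_single (compl hc t) fun s' hs' ↦ ?_
  obtain ⟨a, has', has⟩ := (exists_mem_notMem_iff_ne s' _).1 hs'
  obtain ⟨i, hi⟩ := exists_enum_eq_of_mem has'
  obtain ⟨j, hj⟩ := exists_enum_eq_of_mem (not_not.1 (mt mem_compl.2 has))
  rw [volumeForm_append_cast_eq_zero o _ h (i := i) (j := j) (hi.trans hj.symm), mul_zero]

/-- The volume factor of `hodgeStar_apply_multiIndex_eq_compl` squares to `1`:
`vol(b ∘ [e tᶜ | e t])² = 1`, since `b ∘ [e tᶜ | e t]` is a permuted orthonormal basis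
(`volumeForm_comp_mul_self`). [folklore] -/
theorem volumeForm_compl_append_mul_self (h : k + m = n) (hc : k + m = Fintype.card (Fin n))
    (t : Set.powersetCard (Fin n) m) :
    o.volumeForm (stdOrthonormalBasisFin V n ∘
        (Fin.append (ofFinEmbEquiv.symm (compl hc t)) (ofFinEmbEquiv.symm t) ∘ Fin.cast h.symm)) *
      o.volumeForm (stdOrthonormalBasisFin V n ∘
        (Fin.append (ofFinEmbEquiv.symm (compl hc t)) (ofFinEmbEquiv.symm t) ∘ Fin.cast h.symm)) =
      1 :=
  volumeForm_comp_mul_self o (stdOrthonormalBasisFin V n)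
    (append_cast_injective h (ofFinEmbEquiv.symm (compl hc t)).injective
      (ofFinEmbEquiv.symm t).injective
      fun i j hij ↦ mem_compl.1 (enum_mem (compl hc t) i) (hij ▸ enum_mem t j)).bijective_of_finite

end StarCompl

end HodgeStarAux

section Isometry

open HodgeStarAux

variable {V : Type*} [NormedAddCommGroup V] [InnerProductSpace ℝ V] [FiniteDimensional ℝ V]
  {n : ℕ} [Fact (finrank ℝ V = n)] (o : Orientation ℝ V (Fin n)) {k m : ℕ}

/-- **Discharge of `alternatingFormInner_hodgeStar_hodgeStar`**: the Hodge star is an isometry for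
the induced inner products on forms, `⟪⋆α, ⋆β⟫ = ⟪α, β⟫` for continuous alternating `k`-forms
`α, β` on an oriented `n`-dimensional real inner product space, `k + m = n`. Source: Warner,
*Foundations of Differentiable Manifolds and Lie Groups*, Ch. 2, Exercise 13, pp. 79–80, where `⋆`
is *defined* by `⋆(e_1 ∧ ⋯ ∧ e_p) = ± e_{p+1} ∧ ⋯ ∧ e_n` for any orthonormal basis (eq. (3)) and the
`e_{i₁} ∧ ⋯ ∧ e_{i_p}` form an orthonormal basis of `Λ_p(V)` (eq. (1)); the isometry is the
immediate consequence (an orthonormal basis goes to `±` an orthonormal basis) and is not displayed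
separately by Warner (it also follows from his eqs. (5) `⋆⋆ = (-1)^{p(n-p)}` and (6)
`⟨v, w⟩ = ⋆(v ∧ ⋆w)`); the fact's own tag "Ex. 2.13 (e)" refers to this consequence of Exercise 13.
Proof: `hodgeStar_apply_multiIndex_eq_compl`, `volumeForm_compl_append_mul_self`, and reindexing
along `Set.powersetCard.compl`. [cite: WarnerGTM94, Ch. 2 Ex. 13 (1), (3), pp. 79–80] -/
theorem alternatingFormInner_hodgeStar_hodgeStar_holds :
    alternatingFormInner_hodgeStar_hodgeStar o (k := k) (m := m) := by
  intro h α β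
  have hc : k + m = Fintype.card (Fin n) := by rw [Fintype.card_fin, h]
  rw [alternatingFormInner_apply, alternatingFormInner_apply, ← (compl hc).sum_comp]
  refine Finset.sum_congr rfl fun t _ ↦ ?_
  rw [hodgeStar_apply_multiIndex_eq_compl o h hc, hodgeStar_apply_multiIndex_eq_compl o h hc]
  linear_combination
    (α ((stdOrthonormalBasisFin V n).multiIndex (compl hc t)) *
      β ((stdOrthonormalBasisFin V n).multiIndex (compl hc t))) *
      volumeForm_compl_append_mul_self o h hc t

end Isometry

end Literature.Geometry.Kaehler
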